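import Summits.QuantumFields.GaugeBoot.DiagonalRPTorusRestDictionary
import Literature.MathematicalPhysics.QuantumFieldTheory.WilsonFlow
import HarnessLib

/-!
# The trick form of a difference witness is a signed sum of TRUNCATED rest correlations
(gauge-boot, L3 `d = 3` uniform window, brick 3)

HONEST FRAMING (cell `pub-gaugeboot`, page 1 of every file): the venture produces certified bounds
on lattice expectations at stated coupling, gauge group, dimension and torus size; NOT a mass gap,
NOT a continuum limit, NOT a string tension; NOT Yang–Mills-summit-bearing (barriers
`FixedCouplingUltralocality`, `PerturbativeInvisibility`). This module is bookkeeping for the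
structural NEGATIVE results on diagonal reflection positivity of tori; it discharges nothing by
itself.

## Content (torus `(ℤ/L)^d`, mirror `y_i = y_j`, threshold `h`, compact metrisable `G`,
## continuous `ρ`)

The half-action trick (`DiagonalRPTorusHalfAction.wilsonExpectation_trick_eq`) reduces a
refutation of diagonal RP to the sign of
`trickForm A = ∫ A(ΘU) A(U) ∏_{q ∈ rest} e^{β Re tr ρ(U_q)}`, i.e. of the rest expectation
`⟨(A∘Θ)·A⟩_rest` (`DiagonalRPTorusRestDictionary`). All witnesses of the lane are
DIFFERENCES `A = O₁ - O₂` of two observables with the same rest expectation (a plaquette /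
loop and a translate). Here:

* **symmetries of the rest measure**: relabelling the links by a permutation preserves product
  Haar measure (`measurePreserving_relabel`, Mathlib `measurePreserving_piCongrLeft`); the swap
  `Θ = configDiagSwap i j` and the translations `siteTranslate a` (tree, `WilsonFlow`) are such
  relabellings (`measurePreserving_configDiagSwap`, `measurePreserving_siteTranslate`); the set
  of rest plaquettes is invariant under `θ` (`plaqSwap_mem_restPlaqs_iff`) and under the
  translations by vectors `a` of layer `δ(a) = a_i - a_j = 0` (`plaqTranslate_mem_restPlaqs_iff`),
  hence so is the rest weight (`restWeight_configDiagSwap`, `restWeight_siteTranslate`) and the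
  rest expectation: `⟨O∘Θ⟩_rest = ⟨O⟩_rest` (`restExpect_comp_configDiagSwap`),
  `⟨O∘τ_a⟩_rest = ⟨O⟩_rest` (`restExpect_comp_siteTranslate`).
* ★ **`trickForm_sub_eq`** — for bounded measurable `O₁, O₂` with `⟨O₁⟩_rest = ⟨O₂⟩_rest`:
  `trickForm (O₁ - O₂) = restZ · (κ(O₁Θ, O₁) - κ(O₁Θ, O₂) - κ(O₂Θ, O₁) + κ(O₂Θ, O₂))`,
  `κ(F, H) = ⟨FH⟩_rest - ⟨F⟩_rest ⟨H⟩_rest` (`DiagRPUnif.restTrunc`), `FΘ = F∘Θ`: the PRODUCT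
  TERMS CANCEL EXACTLY (`⟨O_iΘ⟩ = ⟨O_i⟩` by `Θ`-invariance and `⟨O₁⟩ = ⟨O₂⟩`), so only truncated
  correlations remain. ★ **`trickForm_sub_translate_eq`**: the case `O₂ = O₁ ∘ τ_a`, `δ(a) = 0`.

Use (architecture note `HOME/pub-gaugeboot-lean3/gen46/D3-UNIFORM-PLAN.md`): the two DIAGONAL
terms `κ(O_iΘ, O_i)` join supports at torus distance `≍ L` and are exponentially small UNIFORMLY
in `L` by `DiagonalRPTorusRestClustering.abs_restTrunc_le`; the sign of the trick form is then the
sign of `-2κ(O₁Θ, O₂)`, the truncated correlation of the NEAR pair — in `d ≥ 4` the tube of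
`DiagonalRPTorusTubeShape`, in `d = 3` the ten-face annuli of the bent hexagons (open).

Elementary; no named fact.
-/

open MeasureTheory Finset Function

namespace Summit.QuantumFields.GaugeBoot

open Literature.MathematicalPhysics.QuantumFieldTheory

noncomputable section

namespace DiagRPUnif

open DiagRPTube

/-! ## Relabelling symmetries of product Haar measure -/

section Relabel

variable {d L : ℕ} [NeZero L] {G : Type*} [MeasurableSpace G]

omit [NeZero L] in
/-- Relabelling the links by a bijection `τ` is the measurable equivalence `piCongrLeft τ`:
`(piCongrLeft τ) U = U ∘ τ⁻¹`. -/
theorem coe_piCongrLeft_equiv (τ : Edge d L ≃ Edge d L) :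
    ⇑(MeasurableEquiv.piCongrLeft (fun _ : Edge d L => G) τ) =
      fun (U : GaugeConfig d L G) e => U (τ.symm e) := by
  funext U e
  rw [MeasurableEquiv.coe_piCongrLeft]
  have h1 := Equiv.piCongrLeft_apply_apply (P := fun _ : Edge d L => G) (e := τ) U (τ.symm e)
  rw [Equiv.apply_symm_apply] at h1
  exact h1

/-- **Relabelling the links by a bijection preserves every product of copies of one σ-finite
measure.** -/
theorem measurePreserving_relabel (τ : Edge d L ≃ Edge d L) (μ₀ : Measure G) [SigmaFinite μ₀] :
    MeasurePreserving (fun (U : GaugeConfig d L G) e => U (τ.symm e)) (Measure.pi fun _ => μ₀)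
      (Measure.pi fun _ => μ₀) := by
  have h := MeasureTheory.measurePreserving_piCongrLeft (fun _ : Edge d L => μ₀) τ
  rwa [coe_piCongrLeft_equiv τ] at h

/-- Integrals are invariant under relabelling (no measurability needed). -/
theorem integral_comp_relabel (τ : Edge d L ≃ Edge d L) (μ₀ : Measure G) [SigmaFinite μ₀]
    (F : GaugeConfig d L G → ℝ) :
    ∫ U, F (fun e => U (τ.symm e)) ∂(Measure.pi fun _ : Edge d L => μ₀) =
      ∫ U, F U ∂(Measure.pi fun _ : Edge d L => μ₀) := by
  have h : MeasurePreserving (MeasurableEquiv.piCongrLeft (fun _ : Edge d L => G) τ)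
      (Measure.pi fun _ : Edge d L => μ₀) (Measure.pi fun _ : Edge d L => μ₀) :=
    MeasureTheory.measurePreserving_piCongrLeft (fun _ : Edge d L => μ₀) τ
  have h2 := h.integral_comp' F
  rwa [coe_piCongrLeft_equiv τ] at h2

/-- The diagonal swap of links as a permutation (an involution). -/
def edgeDiagSwapPerm (i j : Fin d) : Equiv.Perm (Edge d L) :=
  Function.Involutive.toPerm (edgeDiagSwap i j) (edgeDiagSwap_edgeDiagSwap i j)

omit [NeZero L] [MeasurableSpace G] in
/-- `Θ` is the relabelling by the swap of links. -/
theorem configDiagSwap_eq_relabel (i j : Fin d) (U : GaugeConfig d L G) :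
    configDiagSwap i j U = fun e => U ((edgeDiagSwapPerm (L := L) i j).symm e) := rfl

/-- **The swap `Θ` preserves product Haar measure** (every `d`; the `d = 2` case is
`DiagRPTwo.measurePreserving_configDiagSwap`). -/
theorem measurePreserving_configDiagSwap (i j : Fin d) (μ₀ : Measure G) [SigmaFinite μ₀] :
    MeasurePreserving (configDiagSwap (G := G) (L := L) i j) (Measure.pi fun _ => μ₀)
      (Measure.pi fun _ => μ₀) :=
  measurePreserving_relabel (edgeDiagSwapPerm i j) μ₀

/-- The translation of links by `a`, as a permutation. -/
def edgeTranslatePerm (a : Site d L) : Equiv.Perm (Edge d L) where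
  toFun e := (e.1 - a, e.2)
  invFun e := (e.1 + a, e.2)
  left_inv e := by simp
  right_inv e := by simp

omit [NeZero L] [MeasurableSpace G] in
/-- `τ_a` is the relabelling by the translation of links. -/
theorem siteTranslate_eq_relabel (a : Site d L) (U : GaugeConfig d L G) :
    U.siteTranslate a = fun e => U ((edgeTranslatePerm (L := L) a).symm e) := rfl

/-- **Translations preserve product Haar measure.** -/
theorem measurePreserving_siteTranslate (a : Site d L) (μ₀ : Measure G) [SigmaFinite μ₀] :
    MeasurePreserving (GaugeConfig.siteTranslate (G := G) (L := L) a) (Measure.pi fun _ => μ₀)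
      (Measure.pi fun _ => μ₀) :=
  measurePreserving_relabel (edgeTranslatePerm a) μ₀

end Relabel

/-! ## Invariance of the rest plaquettes and of the rest weight -/

section RestInvariance

variable {d L : ℕ} [NeZero L] {N : ℕ} {G : Type*} [Group G] (ρ : G →* Matrix (Fin N) (Fin N) ℂ)
  {i j : Fin d} {h : ℕ}

/-- **The rest is `θ`-invariant**: `θq ∈ restPlaqs ↔ q ∈ restPlaqs`. -/
theorem plaqSwap_mem_restPlaqs_iff (q : Plaquette d L) :
    plaqSwap i j q ∈ restPlaqs i j h ↔ q ∈ restPlaqs i j h := by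
  rw [mem_restPlaqs, mem_restPlaqs, mem_swapPlaqs, mem_swapPlaqs, plaqSwap_plaqSwap]
  exact and_comm

/-- The translate `q + a` of a plaquette. -/
def plaqTranslate (a : Site d L) (q : Plaquette d L) : Plaquette d L := (q.1 + a, q.2)

omit [NeZero L] in
/-- Vertices of the translate. -/
theorem vert_plaqTranslate (a : Site d L) (q : Plaquette d L) (b : Fin 4) :
    vert (plaqTranslate a q) b = vert q b + a := by
  fin_cases b <;> simp only [vert, plaqTranslate, Site.shift] <;> abel

omit [NeZero L] in
/-- Layers are translation covariant: `δ(y + a) = δ(y) + δ(a)`. -/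
theorem lay_add (y a : Site d L) : lay i j (y + a) = lay i j y + lay i j a := by
  simp only [lay, Pi.add_apply]; ring

omit [NeZero L] in
/-- `θ(y + a) = θy + θa`. -/
theorem siteDiagSwap_add (y a : Site d L) :
    siteDiagSwap i j (y + a) = siteDiagSwap i j y + siteDiagSwap i j a := rfl

omit [NeZero L] in
/-- `θ(q + a) = θq + θa`. -/
theorem plaqSwap_plaqTranslate (a : Site d L) (q : Plaquette d L) :
    plaqSwap i j (plaqTranslate a q) = plaqTranslate (siteDiagSwap i j a) (plaqSwap i j q) := rfl

/-- The inner plaquettes are invariant under translations inside the layers (`δ(a) = 0`). -/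
theorem plaqTranslate_mem_innerPlaqs_iff {a : Site d L} (ha : lay i j a = 0) (q : Plaquette d L) :
    plaqTranslate a q ∈ innerPlaqs i j h ↔ q ∈ innerPlaqs i j h := by
  simp only [mem_innerPlaqs, PlaqIn, InHalf, PlaqMirror, vert_plaqTranslate, lay_add, ha, add_zero]

/-- **The rest is invariant under translations inside the layers** (`δ(a) = 0`). -/
theorem plaqTranslate_mem_restPlaqs_iff {a : Site d L} (ha : lay i j a = 0) (q : Plaquette d L) :
    plaqTranslate a q ∈ restPlaqs i j h ↔ q ∈ restPlaqs i j h := by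
  have ha' : lay i j (siteDiagSwap i j a) = 0 := by rw [lay_siteDiagSwap, ha, neg_zero]
  rw [mem_restPlaqs, mem_restPlaqs, mem_swapPlaqs, mem_swapPlaqs, plaqSwap_plaqTranslate,
    plaqTranslate_mem_innerPlaqs_iff ha, plaqTranslate_mem_innerPlaqs_iff ha']

omit [NeZero L] in
/-- Plaquette values of a translated configuration. -/
theorem plaqRe_siteTranslate (a : Site d L) (U : GaugeConfig d L G) (q : Plaquette d L) :
    WilsonRP.plaqRe ρ (U.siteTranslate a) q = WilsonRP.plaqRe ρ U (plaqTranslate a q) := by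
  simp only [WilsonRP.plaqRe, plaquetteHolonomy_siteTranslate, plaqTranslate]

variable [TopologicalSpace G] [IsTopologicalGroup G] [CompactSpace G]

/-- **The rest weight is `Θ`-invariant.** -/
theorem restWeight_configDiagSwap (hρ : Continuous ρ) (β : ℝ) (U : GaugeConfig d L G) :
    restWeight ρ i j h β (configDiagSwap i j U) = restWeight ρ i j h β U := by
  unfold restWeight
  simp_rw [plaqRe_configDiagSwap ρ hρ i j U]
  exact prod_equiv (plaqSwapEquiv i j)
    (fun q => (plaqSwap_mem_restPlaqs_iff (i := i) (j := j) (h := h) q).symm) fun q _ => rfl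

omit [TopologicalSpace G] [IsTopologicalGroup G] [CompactSpace G] in
/-- **The rest weight is invariant under translations inside the layers.** -/
theorem restWeight_siteTranslate {a : Site d L} (ha : lay i j a = 0) (β : ℝ)
    (U : GaugeConfig d L G) :
    restWeight ρ i j h β (U.siteTranslate a) = restWeight ρ i j h β U := by
  unfold restWeight
  simp_rw [plaqRe_siteTranslate ρ a U]
  refine prod_equiv ⟨plaqTranslate a, plaqTranslate (-a), fun q => ?_, fun q => ?_⟩
    (fun q => (plaqTranslate_mem_restPlaqs_iff (h := h) ha q).symm) fun q _ => rfl
  · simp [plaqTranslate]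
  · simp [plaqTranslate]

end RestInvariance

/-! ## Invariance of rest expectations; the cancellation -/

section Cancellation

variable {d L : ℕ} [NeZero L] {N : ℕ} {G : Type*} [Group G] [TopologicalSpace G]
  [IsTopologicalGroup G] [CompactSpace G] [MeasurableSpace G] [BorelSpace G]
  [SecondCountableTopology G] (ρ : G →* Matrix (Fin N) (Fin N) ℂ) (β : ℝ) (i j : Fin d) (h : ℕ)

omit [SecondCountableTopology G] in
/-- `restNum` of the rest is the integral against the rest weight. -/
theorem restNum_restPlaqs_eq (f : GaugeConfig d L G → ℝ) :
    restNum ρ β (restPlaqs i j h) f =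
      ∫ U, f U * restWeight ρ i j h β U ∂Measure.pi fun _ : Edge d L => haarProbability G := rfl

omit [SecondCountableTopology G] in
/-- **`Θ`-invariance of the rest measure**: `restNum (O∘Θ) = restNum O`. -/
theorem restNum_comp_configDiagSwap (hρ : Continuous ρ) (O : GaugeConfig d L G → ℝ) :
    restNum ρ β (restPlaqs i j h) (fun U => O (configDiagSwap i j U)) =
      restNum ρ β (restPlaqs i j h) O := by
  rw [restNum_restPlaqs_eq, restNum_restPlaqs_eq, ← integral_comp_relabel (L := L)
    (edgeDiagSwapPerm i j) (haarProbability G) (fun V => O V * restWeight ρ i j h β V)]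
  refine integral_congr_ae (ae_of_all _ fun U => ?_)
  change O (configDiagSwap i j U) * restWeight ρ i j h β U =
    O (configDiagSwap i j U) * restWeight ρ i j h β (configDiagSwap i j U)
  rw [restWeight_configDiagSwap ρ hρ]

omit [SecondCountableTopology G] in
/-- **Translation invariance of the rest measure inside the layers**: `restNum (O∘τ_a) = restNum O`
for `δ(a) = 0`. -/
theorem restNum_comp_siteTranslate {a : Site d L} (ha : lay i j a = 0)
    (O : GaugeConfig d L G → ℝ) :
    restNum ρ β (restPlaqs i j h) (fun U : GaugeConfig d L G => O (U.siteTranslate a)) =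
      restNum ρ β (restPlaqs i j h) O := by
  rw [restNum_restPlaqs_eq, restNum_restPlaqs_eq, ← integral_comp_relabel (L := L)
    (edgeTranslatePerm a) (haarProbability G) (fun V => O V * restWeight ρ i j h β V)]
  refine integral_congr_ae (ae_of_all _ fun U => ?_)
  change O (GaugeConfig.siteTranslate a U) * restWeight ρ i j h β U =
    O (GaugeConfig.siteTranslate a U) * restWeight ρ i j h β (GaugeConfig.siteTranslate a U)
  rw [restWeight_siteTranslate ρ ha]

omit [SecondCountableTopology G] in
/-- `⟨O∘Θ⟩_rest = ⟨O⟩_rest`. -/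
theorem restExpect_comp_configDiagSwap (hρ : Continuous ρ) (O : GaugeConfig d L G → ℝ) :
    restExpect ρ β (restPlaqs i j h) (fun U => O (configDiagSwap i j U)) =
      restExpect ρ β (restPlaqs i j h) O := by
  rw [restExpect, restExpect, restNum_comp_configDiagSwap ρ β i j h hρ]

omit [SecondCountableTopology G] in
/-- `⟨O∘τ_a⟩_rest = ⟨O⟩_rest` for `δ(a) = 0`. -/
theorem restExpect_comp_siteTranslate {a : Site d L} (ha : lay i j a = 0)
    (O : GaugeConfig d L G → ℝ) :
    restExpect ρ β (restPlaqs i j h) (fun U : GaugeConfig d L G => O (U.siteTranslate a)) =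
      restExpect ρ β (restPlaqs i j h) O := by
  rw [restExpect, restExpect, restNum_comp_siteTranslate ρ β i j h ha]

/-- `restNum = restZ · restExpect`. -/
theorem restNum_eq_restZ_mul (hρ : Continuous ρ) (V : Finset (Plaquette d L))
    (f : GaugeConfig d L G → ℝ) : restNum ρ β V f = restZ ρ β V * restExpect ρ β V f := by
  rw [restExpect, mul_div_cancel₀ _ (restZ_pos ρ β hρ V).ne']

omit [NeZero L] [Group G] [TopologicalSpace G] [IsTopologicalGroup G] [CompactSpace G]
  [BorelSpace G] [SecondCountableTopology G] in
/-- `O∘Θ` is measurable with `O`. -/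
theorem measurable_comp_configDiagSwap {O : GaugeConfig d L G → ℝ} (hO : Measurable O) :
    Measurable fun U => O (configDiagSwap i j U) :=
  hO.comp (measurable_pi_lambda _ fun _ => measurable_pi_apply _)

omit [NeZero L] [Group G] [TopologicalSpace G] [IsTopologicalGroup G] [CompactSpace G]
  [BorelSpace G] [SecondCountableTopology G] in
/-- `O∘τ_a` is measurable with `O`. -/
theorem measurable_comp_siteTranslate (a : Site d L) {O : GaugeConfig d L G → ℝ}
    (hO : Measurable O) : Measurable fun U : GaugeConfig d L G => O (U.siteTranslate a) :=
  hO.comp (measurable_pi_lambda _ fun _ => measurable_pi_apply _)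

/-- ★ **THE PRODUCT TERMS CANCEL.** For bounded measurable `O₁`, `O₂` with the same rest
expectation, the trick form of the difference witness `A = O₁ - O₂` is `restZ` times the signed sum
of the four TRUNCATED rest correlations `κ(O_aΘ, O_b)`, `κ(F, H) = ⟨FH⟩_rest - ⟨F⟩_rest⟨H⟩_rest`. -/
theorem trickForm_sub_eq (hρ : Continuous ρ) {O₁ O₂ : GaugeConfig d L G → ℝ} (h₁m : Measurable O₁)
    (h₂m : Measurable O₂) {C₁ C₂ : ℝ} (h₁b : ∀ U, |O₁ U| ≤ C₁) (h₂b : ∀ U, |O₂ U| ≤ C₂)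
    (hmean : restExpect ρ β (restPlaqs i j h) O₁ = restExpect ρ β (restPlaqs i j h) O₂) :
    trickForm ρ i j h β (fun U => O₁ U - O₂ U) =
      restZ ρ β (restPlaqs (L := L) i j h) *
        (restTrunc ρ β (restPlaqs i j h) (fun U => O₁ (configDiagSwap i j U)) O₁ -
          restTrunc ρ β (restPlaqs i j h) (fun U => O₁ (configDiagSwap i j U)) O₂ -
          restTrunc ρ β (restPlaqs i j h) (fun U => O₂ (configDiagSwap i j U)) O₁ +
          restTrunc ρ β (restPlaqs i j h) (fun U => O₂ (configDiagSwap i j U)) O₂) := by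
  set R := restPlaqs (L := L) i j h with hR
  -- shorthand for the four products
  have hC₁ : 0 ≤ C₁ := (abs_nonneg _).trans (h₁b 1)
  have hC₂ : 0 ≤ C₂ := (abs_nonneg _).trans (h₂b 1)
  have hprod : ∀ {F H : GaugeConfig d L G → ℝ} {CF CH : ℝ}, Measurable F → Measurable H →
      (∀ U, |F U| ≤ CF) → (∀ U, |H U| ≤ CH) →
      Measurable (fun U => F U * H U) ∧ ∀ U, |F U * H U| ≤ CF * CH := by
    intro F H CF CH hF hH hFb hHb
    refine ⟨hF.mul hH, fun U => ?_⟩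
    rw [abs_mul]
    exact mul_le_mul (hFb U) (hHb U) (abs_nonneg _) ((abs_nonneg _).trans (hFb U))
  have h₁Θm := measurable_comp_configDiagSwap i j h₁m
  have h₂Θm := measurable_comp_configDiagSwap i j h₂m
  have h₁Θb : ∀ U, |O₁ (configDiagSwap i j U)| ≤ C₁ := fun U => h₁b _
  have h₂Θb : ∀ U, |O₂ (configDiagSwap i j U)| ≤ C₂ := fun U => h₂b _
  obtain ⟨m11, b11⟩ := hprod h₁Θm h₁m h₁Θb h₁b
  obtain ⟨m12, b12⟩ := hprod h₁Θm h₂m h₁Θb h₂b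
  obtain ⟨m21, b21⟩ := hprod h₂Θm h₁m h₂Θb h₁b
  obtain ⟨m22, b22⟩ := hprod h₂Θm h₂m h₂Θb h₂b
  -- expand the integrand
  have hexp : trickForm ρ i j h β (fun U => O₁ U - O₂ U) =
      restNum ρ β R (fun U =>
        (O₁ (configDiagSwap i j U) * O₁ U - O₁ (configDiagSwap i j U) * O₂ U) -
        (O₂ (configDiagSwap i j U) * O₁ U - O₂ (configDiagSwap i j U) * O₂ U)) := by
    rw [trickForm_eq_restNum]
    unfold restNum
    refine integral_congr_ae (ae_of_all _ fun U => ?_)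
    simp only
    ring
  have mA : Measurable fun U =>
      O₁ (configDiagSwap i j U) * O₁ U - O₁ (configDiagSwap i j U) * O₂ U := m11.sub m12
  have mB : Measurable fun U =>
      O₂ (configDiagSwap i j U) * O₁ U - O₂ (configDiagSwap i j U) * O₂ U := m21.sub m22
  have bA : ∀ U, |O₁ (configDiagSwap i j U) * O₁ U - O₁ (configDiagSwap i j U) * O₂ U| ≤
      C₁ * C₁ + C₁ * C₂ := fun U => (abs_sub _ _).trans (add_le_add (b11 U) (b12 U))
  have bB : ∀ U, |O₂ (configDiagSwap i j U) * O₁ U - O₂ (configDiagSwap i j U) * O₂ U| ≤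
      C₂ * C₁ + C₂ * C₂ := fun U => (abs_sub _ _).trans (add_le_add (b21 U) (b22 U))
  rw [hexp, restNum_sub ρ β hρ R mA mB bA bB,
    restNum_sub ρ β hρ R m11 m12 b11 b12, restNum_sub ρ β hρ R m21 m22 b21 b22,
    restNum_eq_restZ_mul ρ β hρ, restNum_eq_restZ_mul ρ β hρ, restNum_eq_restZ_mul ρ β hρ,
    restNum_eq_restZ_mul ρ β hρ]
  -- the single expectations
  have e1 : restExpect ρ β R (fun U => O₁ (configDiagSwap i j U)) = restExpect ρ β R O₁ :=
    restExpect_comp_configDiagSwap ρ β i j h hρ O₁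
  have e2 : restExpect ρ β R (fun U => O₂ (configDiagSwap i j U)) = restExpect ρ β R O₁ := by
    rw [restExpect_comp_configDiagSwap ρ β i j h hρ O₂, ← hmean]
  unfold restTrunc
  rw [e1, e2, ← hmean]
  ring

/-- ★ **The translated witness.** For a bounded measurable `O` and a translation vector `a` inside
the layers (`δ(a) = a_i - a_j = 0`), with `O₂ = O ∘ τ_a`:
`trickForm (O - O∘τ_a) = restZ · (κ(OΘ, O) - κ(OΘ, Oτ_a) - κ(Oτ_aΘ, O) + κ(Oτ_aΘ, Oτ_a))`. -/
theorem trickForm_sub_translate_eq (hρ : Continuous ρ) {O : GaugeConfig d L G → ℝ}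
    (hOm : Measurable O) {C : ℝ} (hOb : ∀ U, |O U| ≤ C) {a : Site d L} (ha : lay i j a = 0) :
    trickForm ρ i j h β (fun U : GaugeConfig d L G => O U - O (U.siteTranslate a)) =
      restZ ρ β (restPlaqs (L := L) i j h) *
        (restTrunc ρ β (restPlaqs i j h) (fun U => O (configDiagSwap i j U)) O -
          restTrunc ρ β (restPlaqs i j h) (fun U => O (configDiagSwap i j U))
            (fun U : GaugeConfig d L G => O (U.siteTranslate a)) -
          restTrunc ρ β (restPlaqs i j h)
            (fun U => O (GaugeConfig.siteTranslate a (configDiagSwap i j U))) O +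
          restTrunc ρ β (restPlaqs i j h)
            (fun U => O (GaugeConfig.siteTranslate a (configDiagSwap i j U)))
            (fun U : GaugeConfig d L G => O (U.siteTranslate a))) :=
  trickForm_sub_eq ρ β i j h hρ hOm (measurable_comp_siteTranslate a hOm) hOb (fun _ => hOb _)
    (restExpect_comp_siteTranslate ρ β i j h ha O).symm

end Cancellation

end DiagRPUnif

end

end Summit.QuantumFields.GaugeBoot
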